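import Literature.NumberTheory.GaloisRepresentations.LabelledWeightsRankOneBaseChange
import Literature.NumberTheory.GaloisRepresentations.LabelFilDTransport
import Mathlib.LinearAlgebra.Dual.Lemmas
import HarnessLib

/-!
# Labelled Hodge–Tate weights under extension of the coefficient model (any rank)

For a period-ring datum `𝔅` of `Γ` over `F/P`, a tower of coefficient fields `P ⊆ E₀ ⊆ E`, a framed
representation `r₀ : Γ → GL_n(E₀)` with base change `r = r₀ ⊗_{E₀} E`, an embedding `τ₀ : F → E₀`
with `τ = (E₀ ⊆ E) ∘ τ₀`, and the inclusion `ι : E₀ⁿ ⊗_P B → Eⁿ ⊗_P B` (`PeriodRingData.coeffIncl`),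
this file removes the rank-one hypothesis from the accepted
`labelledHodgeTateWeights_baseChange_of_finrank_eq_one` (`LabelledWeightsRankOneBaseChange`):

* `exists_coordRetraction` — the **coordinate retractions** `R_φ = φⁿ ⊗ id : Eⁿ ⊗_P B → E₀ⁿ ⊗_P B`
  of `ι`, one for each `E₀`-linear functional `φ : E → E₀`: `R_φ (c • ι x) = φ(c) • x` and
  `R_φ (Eⁿ ⊗ Fil^i B) ⊆ E₀ⁿ ⊗ Fil^i B`; they map `E · ι(W)` into `W` (`mem_of_mem_span_coeffIncl`) and
  hence `Fil^i D_τ(r)` into `Fil^i D_{τ₀}(r₀)` (`exists_coordRetraction_labelFilD`);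
* `labelFilD_baseChange_eq_span` — **the Hodge filtration commutes with extension of the
  coefficient model**: `Fil^i D_τ(r) = E · ι(Fil^i D_{τ₀}(r₀))` (for `E₀` containing the `[F:P]`
  embeddings of `F` and `D_{τ₀}(r₀)` finite-dimensional).  The inclusion `⊇` is formal; for `⊆`,
  split `D_{τ₀} = Fil^i D_{τ₀} ⊕ C₀`, write the `C₀`-component `c` of `y ∈ Fil^i D_τ(r)` on an
  `E₀`-basis `(e_a)` of `C₀` as `c = Σ c_a • ι(e_a)` with `c_a ∈ E`; every retraction sends `c` into
  `Fil^i D_{τ₀} ∩ C₀ = 0`, so `Σ φ(c_a) e_a = 0`, `φ(c_a) = 0` for all `φ`, and `c = 0` (functionals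
  separate the points of the `E₀`-vector space `E`);
* `finrank_labelFilD_baseChange` — `dim_E Fil^i D_τ(r) = dim_{E₀} Fil^i D_{τ₀}(r₀)` for every `i`;
* `labelledHodgeTateWeights_baseChange` — **`HT_τ(r₀ ⊗_{E₀} E) = HT_{τ₀}(r₀)`** in every rank.

This is the change-of-coefficients half of Patrikis's remark that the labelled weights of
`ρ : Γ_K → GL_n(ℚ̄_ℓ)` may be computed on any model over a finite extension `E₀/ℚ_ℓ` containing the
images of all embeddings `K → ℚ̄_ℓ` (the change-of-frame half is the accepted
`labelledHodgeTateWeights_conj`).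

## References
* [Patrikis2019] S. Patrikis, *Variations on a theorem of Tate*, Mem. AMS 258 (2019), §2.3.1
  (labelled weights `HT_τ`), §2.7.1 (independence of the coefficient field).
* [FontaineAsterisque223III] J.-M. Fontaine, *Représentations `p`-adiques semi-stables*,
  Astérisque 223 (1994), Exp. III §1.5, Prop. 1.5.2 (`D_B` commutes with extension of scalars).
* [BarnetlambEtAl2014] T. Barnet-Lamb, T. Gee, D. Geraghty, R. Taylor, *Potential automorphy and
  change of weight*, Ann. of Math. 179 (2014), Introduction (Notation: `HT_τ`).
-/

noncomputable section

open scoped TensorProduct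
open TensorProduct

universe u v v'

namespace Literature.NumberTheory.GaloisRepresentations

namespace PeriodRingData

section CoeffBaseChange

-- Mathlib's own global value of `maxSynthPendingDepth` (see `LabelledWeightsTwist`); the large
-- tensor types also need a higher instance-synthesis budget.
set_option maxSynthPendingDepth 3
set_option synthInstance.maxHeartbeats 100000

variable {Γ : Type u} [Group Γ] [TopologicalSpace Γ] {P : Type v} {F : Type v'} [Field P] [Field F] [Algebra P F]
  {E₀ E : Type*} [Field E₀] [Field E] [Algebra P E₀] [Algebra P E] [Algebra E₀ E] [IsScalarTower P E₀ E]
  [TopologicalSpace E₀] [TopologicalSpace E] [IsTopologicalRing E₀] [IsTopologicalRing E]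
  (𝔅 : PeriodRingData.{u, v, v', _} Γ P F) (n : ℕ)

/-! ### The coordinate retractions `R_φ = φⁿ ⊗ id` -/

omit [TopologicalSpace Γ] [TopologicalSpace E₀] [TopologicalSpace E] [IsTopologicalRing E₀] [IsTopologicalRing E] in
/-- **Coordinate retractions.**  For every `E₀`-linear functional `φ : E → E₀` there is a `P`-linear
`R_φ : Eⁿ ⊗_P B → E₀ⁿ ⊗_P B` (namely `φⁿ ⊗ id`) with `R_φ (c • ι x) = φ(c) • x` — the retractions read
off the `E₀`-coordinates of `E · ι(x)` in `Eⁿ ⊗_P B ≅ E ⊗_{E₀} (E₀ⁿ ⊗_P B)` — and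
`R_φ (Eⁿ ⊗ Fil^i B) ⊆ E₀ⁿ ⊗ Fil^i B`.  (For `φ` a retraction of `E₀ ⊆ E` this is the accepted
`exists_retraction_coeffIncl`: extension of the base field is faithfully flat.)
[cite: Lang1965Algebra, Ch. XVI §4 (extension of the base; flatness of free modules)] -/
theorem exists_coordRetraction (φ : E →ₗ[E₀] E₀) :
    ∃ R : (Fin n → E) ⊗[P] 𝔅.B →ₗ[P] (Fin n → E₀) ⊗[P] 𝔅.B,
      (∀ (c : E) (x : (Fin n → E₀) ⊗[P] 𝔅.B), R (c • 𝔅.coeffIncl (E := E) n x) = φ c • x) ∧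
        ∀ (i : ℤ) (y : (Fin n → E) ⊗[P] 𝔅.B), y ∈ 𝔅.coeffFilTensor E (Fin n → E) i →
          R y ∈ 𝔅.coeffFilTensor E₀ (Fin n → E₀) i := by
  refine ⟨TensorProduct.map ((φ.restrictScalars P).compLeft (Fin n)) LinearMap.id, fun c x => ?_,
    fun i y hy => ?_⟩
  · induction x using TensorProduct.induction_on with
    | zero => rw [map_zero, smul_zero, map_zero, smul_zero]
    | tmul m₀ b =>
      rw [coeffIncl_tmul, TensorProduct.smul_tmul', TensorProduct.map_tmul, LinearMap.id_apply,
        TensorProduct.smul_tmul']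
      congr 1
      funext k
      change φ ((c • fun i => algebraMap E₀ E (m₀ i)) k) = (φ c • m₀) k
      simp only [Pi.smul_apply, smul_eq_mul]
      rw [mul_comm c, ← Algebra.smul_def, map_smul, smul_eq_mul, mul_comm]
    | add x y hx hy => rw [map_add, smul_add, map_add, hx, hy, smul_add]
  · refine 𝔅.coeffFilTensor_induction (E := E) (M := Fin n → E)
      (C := fun y => TensorProduct.map ((φ.restrictScalars P).compLeft (Fin n)) LinearMap.id y ∈
        𝔅.coeffFilTensor E₀ (Fin n → E₀) i) ?_ (fun m b hb => ?_) (fun y z hy hz => ?_) hy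
    · rw [map_zero]; exact zero_mem _
    · rw [TensorProduct.map_tmul, LinearMap.id_apply]; exact 𝔅.tmul_mem_coeffFilTensor _ hb
    · rw [map_add]; exact add_mem hy hz

omit [TopologicalSpace Γ] [TopologicalSpace E₀] [TopologicalSpace E] [IsTopologicalRing E₀] [IsTopologicalRing E] in
/-- **A coordinate retraction maps `E · ι(W)` into `W`** for every `E₀`-subspace `W ⊆ E₀ⁿ ⊗_P B`
(the coordinates of `E ⊗_{E₀} W ⊆ E ⊗_{E₀} N` lie in `W`).
[cite: Lang1965Algebra, Ch. XVI §4 (extension of the base; flatness of free modules)] -/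
theorem mem_of_mem_span_coeffIncl {φ : E →ₗ[E₀] E₀}
    {R : (Fin n → E) ⊗[P] 𝔅.B →ₗ[P] (Fin n → E₀) ⊗[P] 𝔅.B}
    (hR : ∀ (c : E) (x : (Fin n → E₀) ⊗[P] 𝔅.B), R (c • 𝔅.coeffIncl (E := E) n x) = φ c • x)
    (W : Submodule E₀ ((Fin n → E₀) ⊗[P] 𝔅.B)) {y : (Fin n → E) ⊗[P] 𝔅.B}
    (hy : y ∈ Submodule.span E (𝔅.coeffIncl (E := E) n '' (W : Set ((Fin n → E₀) ⊗[P] 𝔅.B)))) :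
    R y ∈ W := by
  obtain ⟨k, c, g, rfl⟩ := Submodule.mem_span_set'.1 hy
  rw [map_sum]
  refine Submodule.sum_mem _ fun j _ => ?_
  obtain ⟨w, hw, hgj⟩ := (g j).2
  rw [← hgj, hR]
  exact W.smul_mem _ hw

omit [TopologicalSpace Γ] [TopologicalSpace E₀] [TopologicalSpace E] [IsTopologicalRing E₀] [IsTopologicalRing E]
  [Algebra P E₀] [Algebra P E] [IsScalarTower P E₀ E] in
/-- **Functionals detect vanishing of `E`-coefficients**: if `(e_a)` is an `E₀`-linearly independent
finite family and `Σ_a φ(c_a) e_a = 0` for every `E₀`-linear functional `φ : E → E₀`, then all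
`c_a = 0` (`φ(c_a) = 0` for all `φ`, and functionals separate the points of the `E₀`-vector space `E`):
an `E₀`-free family stays `E`-free after extension of scalars.
[cite: Lang1965Algebra, Ch. XVI §4 (extension of the base; flatness of free modules)] -/
theorem eq_zero_of_forall_functional {ι : Type*} [Fintype ι] {N : Type*} [AddCommGroup N] [Module E₀ N]
    {e : ι → N} (he : LinearIndependent E₀ e) (c : ι → E)
    (h : ∀ φ : E →ₗ[E₀] E₀, ∑ a, φ (c a) • e a = 0) : c = 0 := by
  funext a
  refine (Module.forall_dual_apply_eq_zero_iff E₀ (c a)).1 fun φ => ?_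
  exact Fintype.linearIndependent_iff.1 he (fun a => φ (c a)) (h φ) a

/-! ### The filtration of `D_τ` under extension of the coefficient model -/

variable {n} (r₀ : FramedRep Γ E₀ n) (hc : Continuous (algebraMap E₀ E))

/-- **`E · ι(Fil^i D_{τ₀}(r₀)) ⊆ Fil^i D_τ(r)`** (the formal inclusion: `ι` maps `D_{τ₀}` into `D_τ`
and `E₀ⁿ ⊗ Fil^i` into `Eⁿ ⊗ Fil^i`). [cite: Patrikis2019, §2.7.1] -/
theorem span_coeffIncl_labelFilD_le (τ₀ : F →ₐ[P] E₀) (i : ℤ) :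
    Submodule.span E (𝔅.coeffIncl n ''
        (𝔅.labelFilD (FramedRep.toContinuousRep r₀) τ₀.toRingHom i : Set ((Fin n → E₀) ⊗[P] 𝔅.B))) ≤
      𝔅.labelFilD (FramedRep.toContinuousRep (r₀.baseChange (algebraMap E₀ E) hc))
        (extEmb (E := E) τ₀).toRingHom i := by
  rw [Submodule.span_le]
  rintro _ ⟨x, hx, rfl⟩
  obtain ⟨hxD, hxF⟩ := Submodule.mem_inf.1 hx
  exact Submodule.mem_inf.2
    ⟨𝔅.coeffIncl_mem_labelD r₀ hc τ₀ hxD, (𝔅.coeffIncl_mem_coeffFilTensor_iff n i x).2 hxF⟩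

variable [FiniteDimensional P F] [Algebra.IsSeparable P F]

/-- **Every coordinate retraction maps `Fil^i D_τ(r)` into `Fil^i D_{τ₀}(r₀)`** (for `E₀` splitting
`F`, so that `D_τ(r) = E · ι(D_{τ₀}(r₀))` by the accepted `labelD_baseChange_eq_span`).
[cite: Patrikis2019, §2.7.1] -/
theorem exists_coordRetraction_labelFilD (hsplit₀ : Fintype.card (F →ₐ[P] E₀) = Module.finrank P F)
    (τ₀ : F →ₐ[P] E₀) (φ : E →ₗ[E₀] E₀) :
    ∃ R : (Fin n → E) ⊗[P] 𝔅.B →ₗ[P] (Fin n → E₀) ⊗[P] 𝔅.B,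
      (∀ (c : E) (x : (Fin n → E₀) ⊗[P] 𝔅.B), R (c • 𝔅.coeffIncl (E := E) n x) = φ c • x) ∧
        ∀ (i : ℤ) (y : (Fin n → E) ⊗[P] 𝔅.B),
          y ∈ 𝔅.labelFilD (FramedRep.toContinuousRep (r₀.baseChange (algebraMap E₀ E) hc))
            (extEmb (E := E) τ₀).toRingHom i →
          R y ∈ 𝔅.labelFilD (FramedRep.toContinuousRep r₀) τ₀.toRingHom i := by
  obtain ⟨R, hR, hRfil⟩ := 𝔅.exists_coordRetraction (E₀ := E₀) (E := E) n φ
  refine ⟨R, hR, fun i y hy => ?_⟩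
  obtain ⟨hyD, hyF⟩ := Submodule.mem_inf.1 hy
  rw [𝔅.labelD_baseChange_eq_span r₀ hc hsplit₀ τ₀] at hyD
  exact Submodule.mem_inf.2 ⟨𝔅.mem_of_mem_span_coeffIncl n hR _ hyD, hRfil i y hyF⟩

/-- **The Hodge filtration commutes with extension of the coefficient model**: for `E₀ ⊇` the
`[F:P]` embeddings of `F`, `D_{τ₀}(r₀)` finite-dimensional and `τ = (E₀ ⊆ E) ∘ τ₀`,
`Fil^i D_τ(r₀ ⊗_{E₀} E) = E · ι(Fil^i D_{τ₀}(r₀))` for every `i`.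
[cite: Patrikis2019, §2.7.1] [cite: FontaineAsterisque223III, Exp. III Prop. 1.5.2] -/
theorem labelFilD_baseChange_eq_span (hsplit₀ : Fintype.card (F →ₐ[P] E₀) = Module.finrank P F)
    (τ₀ : F →ₐ[P] E₀) [FiniteDimensional E₀ (𝔅.labelD (FramedRep.toContinuousRep r₀) τ₀.toRingHom)]
    (i : ℤ) :
    𝔅.labelFilD (FramedRep.toContinuousRep (r₀.baseChange (algebraMap E₀ E) hc))
        (extEmb (E := E) τ₀).toRingHom i =
      Submodule.span E (𝔅.coeffIncl n ''
        (𝔅.labelFilD (FramedRep.toContinuousRep r₀) τ₀.toRingHom i : Set ((Fin n → E₀) ⊗[P] 𝔅.B))) := by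
  classical
  refine le_antisymm ?_ (𝔅.span_coeffIncl_labelFilD_le r₀ hc τ₀ i)
  intro y hy
  -- notation: `D₀ = D_{τ₀}(r₀) ⊇ W₀ = Fil^i D_{τ₀}(r₀)`, `ι`
  set D₀ : Submodule E₀ ((Fin n → E₀) ⊗[P] 𝔅.B) := 𝔅.labelD (FramedRep.toContinuousRep r₀) τ₀.toRingHom
    with hD₀
  set W₀ : Submodule E₀ ((Fin n → E₀) ⊗[P] 𝔅.B) :=
    𝔅.labelFilD (FramedRep.toContinuousRep r₀) τ₀.toRingHom i with hW₀
  set ι : (Fin n → E₀) ⊗[P] 𝔅.B →ₗ[E₀] (Fin n → E) ⊗[P] 𝔅.B := 𝔅.coeffIncl (E := E) n with hι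
  have hWD : W₀ ≤ D₀ := 𝔅.labelFilD_le _ _ i
  -- a complement `C₀` of `W₀` inside `D₀`
  obtain ⟨C₀, hWC, hWCD⟩ : ∃ C₀ : Submodule E₀ ((Fin n → E₀) ⊗[P] 𝔅.B), W₀ ⊓ C₀ = ⊥ ∧ W₀ ⊔ C₀ = D₀ := by
    obtain ⟨q, hq⟩ := (W₀.comap D₀.subtype).exists_isCompl
    have hW : W₀ = (W₀.comap D₀.subtype).map D₀.subtype := by
      rw [Submodule.map_comap_subtype, inf_eq_right.2 hWD]
    refine ⟨q.map D₀.subtype, ?_, ?_⟩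
    · rw [hW, ← Submodule.map_inf _ (Submodule.injective_subtype D₀), hq.inf_eq_bot, Submodule.map_bot]
    · rw [hW, ← Submodule.map_sup, hq.sup_eq_top, Submodule.map_subtype_top]
  have hCD : C₀ ≤ D₀ := by rw [← hWCD]; exact le_sup_right
  haveI : FiniteDimensional E₀ C₀ := Submodule.finiteDimensional_of_le hCD
  -- `y = w + c` along `D_τ(r) = E · ι(D₀) ⊆ E · ι(W₀) + E · ι(C₀)`
  have hyD : y ∈ Submodule.span E (ι '' (D₀ : Set ((Fin n → E₀) ⊗[P] 𝔅.B))) := by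
    rw [hι, hD₀, ← 𝔅.labelD_baseChange_eq_span r₀ hc hsplit₀ τ₀]
    exact (Submodule.mem_inf.1 hy).1
  have hsum : Submodule.span E (ι '' (D₀ : Set ((Fin n → E₀) ⊗[P] 𝔅.B))) ≤
      Submodule.span E (ι '' (W₀ : Set ((Fin n → E₀) ⊗[P] 𝔅.B))) ⊔
        Submodule.span E (ι '' (C₀ : Set ((Fin n → E₀) ⊗[P] 𝔅.B))) := by
    rw [Submodule.span_le]
    rintro _ ⟨x, hx, rfl⟩
    rw [← hWCD] at hx
    obtain ⟨w, hw, c', hc', rfl⟩ := Submodule.mem_sup.1 hx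
    rw [map_add]
    exact Submodule.add_mem_sup (Submodule.subset_span ⟨w, hw, rfl⟩) (Submodule.subset_span ⟨c', hc', rfl⟩)
  obtain ⟨w, hw, c, hcC, hwc⟩ := Submodule.mem_sup.1 (hsum hyD)
  -- `w`, hence `c = y - w`, lies in `Fil^i D_τ(r)`
  have hwFil : w ∈ 𝔅.labelFilD (FramedRep.toContinuousRep (r₀.baseChange (algebraMap E₀ E) hc))
      (extEmb (E := E) τ₀).toRingHom i :=
    𝔅.span_coeffIncl_labelFilD_le r₀ hc τ₀ i hw
  have hcFil : c ∈ 𝔅.labelFilD (FramedRep.toContinuousRep (r₀.baseChange (algebraMap E₀ E) hc))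
      (extEmb (E := E) τ₀).toRingHom i := by
    have hcyw : c = y - w := by rw [← hwc]; abel
    rw [hcyw]
    exact sub_mem hy hwFil
  -- write `c` on an `E₀`-basis `(e_a)` of `C₀`: `c = Σ_a cc_a • ι(e_a)`
  let b := Module.finBasis E₀ C₀
  let e : Fin (Module.finrank E₀ C₀) → (Fin n → E₀) ⊗[P] 𝔅.B := C₀.subtype ∘ b
  have he : LinearIndependent E₀ e := b.linearIndependent.map' C₀.subtype C₀.ker_subtype
  have hCe : Submodule.span E₀ (Set.range e) = C₀ := by
    rw [Set.range_comp, ← Submodule.map_span, b.span_eq, Submodule.map_subtype_top]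
  have heC : ∀ a, e a ∈ C₀ := fun a => (b a).2
  have hcspan : c ∈ Submodule.span E (Set.range fun a => ι (e a)) := by
    refine (Submodule.span_le.2 ?_ :
      Submodule.span E (ι '' (C₀ : Set ((Fin n → E₀) ⊗[P] 𝔅.B))) ≤ _) hcC
    rintro _ ⟨x, hx, rfl⟩
    rw [← hCe] at hx
    have hιx : ι x ∈ Submodule.span E₀ (Set.range fun a => ι (e a)) := by
      have := Submodule.mem_map_of_mem (f := ι) hx
      rwa [Submodule.map_span, ← Set.range_comp] at this
    exact Submodule.span_le_restrictScalars E₀ E _ hιx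
  obtain ⟨cc, hcc⟩ := (Submodule.mem_span_range_iff_exists_fun E).1 hcspan
  -- every coordinate retraction kills `c` (`R_φ c ∈ W₀ ∩ C₀ = 0`), i.e. `Σ_a φ(cc_a) e_a = 0`
  have hzero : ∀ φ : E →ₗ[E₀] E₀, ∑ a, φ (cc a) • e a = 0 := by
    intro φ
    obtain ⟨R, hR, hRfil⟩ := 𝔅.exists_coordRetraction_labelFilD r₀ hc hsplit₀ τ₀ φ
    have h1 : R c ∈ W₀ := hRfil i c hcFil
    have h2 : R c ∈ C₀ := 𝔅.mem_of_mem_span_coeffIncl n hR C₀ hcC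
    have h12 : R c ∈ W₀ ⊓ C₀ := Submodule.mem_inf.2 ⟨h1, h2⟩
    rw [hWC, Submodule.mem_bot, ← hcc, map_sum] at h12
    simp_rw [hι, hR] at h12
    exact h12
  have hcc0 : cc = 0 := eq_zero_of_forall_functional (E₀ := E₀) (E := E) he cc hzero
  have hc0 : c = 0 := by
    rw [← hcc, hcc0]
    simp
  rw [← hwc, hc0, add_zero]
  exact hw

/-- `D_τ(r₀ ⊗_{E₀} E) = E · ι(D_{τ₀}(r₀))` is finite-dimensional over `E` when `D_{τ₀}(r₀)` is over
`E₀`. [cite: Patrikis2019, §2.7.1] [cite: FontaineAsterisque223III, Exp. III Prop. 1.5.2] -/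
theorem finiteDimensional_labelD_baseChange (hsplit₀ : Fintype.card (F →ₐ[P] E₀) = Module.finrank P F)
    (τ₀ : F →ₐ[P] E₀) [FiniteDimensional E₀ (𝔅.labelD (FramedRep.toContinuousRep r₀) τ₀.toRingHom)] :
    FiniteDimensional E (𝔅.labelD (FramedRep.toContinuousRep (r₀.baseChange (algebraMap E₀ E) hc))
      (extEmb (E := E) τ₀).toRingHom) := by
  rw [𝔅.labelD_baseChange_eq_span r₀ hc hsplit₀ τ₀]
  haveI := PeriodRingData.finiteDimensional_span_image (E := E) (𝔅.coeffIncl (E := E) n)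
    (𝔅.labelD (FramedRep.toContinuousRep r₀) τ₀.toRingHom)
  infer_instance

/-- **`dim_E Fil^i D_τ(r₀ ⊗_{E₀} E) = dim_{E₀} Fil^i D_{τ₀}(r₀)`** for every `i`.
[cite: Patrikis2019, §2.7.1] -/
theorem finrank_labelFilD_baseChange (hsplit₀ : Fintype.card (F →ₐ[P] E₀) = Module.finrank P F)
    (τ₀ : F →ₐ[P] E₀) [FiniteDimensional E₀ (𝔅.labelD (FramedRep.toContinuousRep r₀) τ₀.toRingHom)]
    (i : ℤ) :
    Module.finrank E (𝔅.labelFilD (FramedRep.toContinuousRep (r₀.baseChange (algebraMap E₀ E) hc))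
        (extEmb (E := E) τ₀).toRingHom i) =
      Module.finrank E₀ (𝔅.labelFilD (FramedRep.toContinuousRep r₀) τ₀.toRingHom i) := by
  haveI : FiniteDimensional E₀ (𝔅.labelFilD (FramedRep.toContinuousRep r₀) τ₀.toRingHom i) :=
    Submodule.finiteDimensional_of_le (𝔅.labelFilD_le _ _ i)
  rw [𝔅.labelFilD_baseChange_eq_span r₀ hc hsplit₀ τ₀ i]
  exact 𝔅.finrank_span_coeffIncl_image (𝔅.labelFilD (FramedRep.toContinuousRep r₀) τ₀.toRingHom i)

/-- **The labelled Hodge–Tate weights are unchanged by extension of the coefficient model** (any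
rank): for `r₀ : Γ → GL_n(E₀)` with `E₀ ⊇` the `[F:P]` embeddings of `F` and `D_{τ₀}(r₀)`
finite-dimensional (e.g. `r₀` admissible for a field `B`, accepted `finrank_labelD_eq_of_isAdmissible`),
and `E/E₀` any (topological) field extension, `HT_τ(r₀ ⊗_{E₀} E) = HT_{τ₀}(r₀)` for
`τ = (E₀ ⊆ E) ∘ τ₀`.  Supersedes the rank-one `labelledHodgeTateWeights_baseChange_of_finrank_eq_one`.
[cite: Patrikis2019, §2.3.1 and §2.7.1] [cite: FontaineAsterisque223III, Exp. III Prop. 1.5.2] -/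
theorem labelledHodgeTateWeights_baseChange (hsplit₀ : Fintype.card (F →ₐ[P] E₀) = Module.finrank P F)
    (τ₀ : F →ₐ[P] E₀) [FiniteDimensional E₀ (𝔅.labelD (FramedRep.toContinuousRep r₀) τ₀.toRingHom)] :
    𝔅.labelledHodgeTateWeights (FramedRep.toContinuousRep (r₀.baseChange (algebraMap E₀ E) hc))
        (extEmb (E := E) τ₀).toRingHom =
      𝔅.labelledHodgeTateWeights (FramedRep.toContinuousRep r₀) τ₀.toRingHom := by
  rw [labelledHodgeTateWeights_def, labelledHodgeTateWeights_def]
  congr 1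
  funext i
  exact 𝔅.finrank_labelFilD_baseChange r₀ hc hsplit₀ τ₀ i

end CoeffBaseChange

end PeriodRingData

/-! ### `ℚ̄_p`-coefficients: the labelled weights are computed on any finite model -/

namespace FramedRep

open Field Literature.NumberTheory.Automorphic PeriodRingData

-- Mathlib's own global value of `maxSynthPendingDepth` (see `LabelledWeightsTwist`); the large
-- tensor types also need a higher instance-synthesis budget.
set_option maxSynthPendingDepth 3
set_option synthInstance.maxHeartbeats 200000

variable {K : Type} [Field K] {p : ℕ} [Fact p.Prime] [Algebra ℚ_[p] K]

/-- **`HT_τ(ρ)` of `ρ : Γ_K →ₜ* GL_n(ℚ̄_p)` is computed on any model** `rE'` of `ρ` over a subfield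
`E' ⊆ ℚ̄_p` containing the `[K:ℚ_p]` embeddings of `K` (with `D_{τ₀}(rE')` finite-dimensional):
`HT_τ(ρ) = HT_{τ₀}(rE')` for the factorisation `τ = (E' ⊆ ℚ̄_p) ∘ τ₀` (change of frame
`labelledHodgeTateWeights_conj`, change of coefficients `labelledHodgeTateWeights_baseChange`).
[cite: Patrikis2019, §2.3.1 and §2.7.1] -/
theorem labelledHodgeTateWeights_eq_of_hasQlModel [FiniteDimensional ℚ_[p] K]
    (𝔅 : PeriodRingData.{0, 0, 0, 0} (absoluteGaloisGroup K) ℚ_[p] K) {n : ℕ}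
    {ρ : FramedRep (absoluteGaloisGroup K) (PadicAlgCl p) n}
    {E' : IntermediateField ℚ_[p] (PadicAlgCl p)} {rE' : FramedRep (absoluteGaloisGroup K) E' n}
    (hmodel : HasQlModel ρ E' rE') (hsplit : Fintype.card (K →ₐ[ℚ_[p]] E') = Module.finrank ℚ_[p] K)
    (τ : K →ₐ[ℚ_[p]] PadicAlgCl p) (τ₀ : K →ₐ[ℚ_[p]] E')
    (hτ : τ.toRingHom = (extEmb (E := PadicAlgCl p) τ₀).toRingHom)
    [FiniteDimensional E' (𝔅.labelD (FramedRep.toContinuousRep rE') τ₀.toRingHom)] :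
    𝔅.labelledHodgeTateWeights (FramedRep.toContinuousRep ρ) τ.toRingHom =
      𝔅.labelledHodgeTateWeights (FramedRep.toContinuousRep rE') τ₀.toRingHom := by
  obtain ⟨Q, hQ⟩ := hmodel
  rw [← hQ, 𝔅.labelledHodgeTateWeights_conj, hτ]
  exact 𝔅.labelledHodgeTateWeights_baseChange rE' continuous_subtype_val hsplit τ₀

/-- Degree-wise form of `labelledHodgeTateWeights_eq_of_hasQlModel`:
`dim_{ℚ̄_p} Fil^i D_τ(ρ) = dim_{E'} Fil^i D_{τ₀}(rE')`. [cite: Patrikis2019, §2.7.1] -/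
theorem finrank_labelFilD_eq_of_hasQlModel [FiniteDimensional ℚ_[p] K]
    (𝔅 : PeriodRingData.{0, 0, 0, 0} (absoluteGaloisGroup K) ℚ_[p] K) {n : ℕ}
    {ρ : FramedRep (absoluteGaloisGroup K) (PadicAlgCl p) n}
    {E' : IntermediateField ℚ_[p] (PadicAlgCl p)} {rE' : FramedRep (absoluteGaloisGroup K) E' n}
    (hmodel : HasQlModel ρ E' rE') (hsplit : Fintype.card (K →ₐ[ℚ_[p]] E') = Module.finrank ℚ_[p] K)
    (τ : K →ₐ[ℚ_[p]] PadicAlgCl p) (τ₀ : K →ₐ[ℚ_[p]] E')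
    (hτ : τ.toRingHom = (extEmb (E := PadicAlgCl p) τ₀).toRingHom)
    [FiniteDimensional E' (𝔅.labelD (FramedRep.toContinuousRep rE') τ₀.toRingHom)] (i : ℤ) :
    Module.finrank (PadicAlgCl p) (𝔅.labelFilD (FramedRep.toContinuousRep ρ) τ.toRingHom i) =
      Module.finrank E' (𝔅.labelFilD (FramedRep.toContinuousRep rE') τ₀.toRingHom i) := by
  obtain ⟨Q, hQ⟩ := hmodel
  rw [← hQ, 𝔅.labelFilD_conj, LinearEquiv.finrank_map_eq, hτ]
  exact 𝔅.finrank_labelFilD_baseChange rE' continuous_subtype_val hsplit τ₀ i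

/-- **A de Rham `ρ : Γ_K →ₜ* GL_n(ℚ̄_p)` has a finite admissible model computing all its labelled
weights**: there are a finite `E'/ℚ_p` inside `ℚ̄_p` containing every `τ(K)` and a model `rE'` of
`ρ` over `E'` with `rE'|_{ℚ_p}` `B`-admissible such that, for every `τ : K → ℚ̄_p`, `τ` factors as
`(E' ⊆ ℚ̄_p) ∘ τ₀`, `D_{τ₀}(rE')` is an `E'`-space of dimension `n`, and
`Fil^i D_τ(ρ)`, `HT_τ(ρ)` are read off `rE'`: `dim Fil^i D_τ(ρ) = dim Fil^i D_{τ₀}(rE')`,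
`HT_τ(ρ) = HT_{τ₀}(rE')` (period ring a field, e.g. `B_dR(K)`; `K/ℚ_p` finite).
[cite: FontaineAsterisque223III, Exp. III Prop. 1.5.2] [cite: Patrikis2019, §2.7.1] -/
theorem IsDeRhamWith.exists_hasQlModel_labelledHodgeTateWeights_eq [FiniteDimensional ℚ_[p] K]
    (𝔅 : PeriodRingData.{0, 0, 0, 0} (absoluteGaloisGroup K) ℚ_[p] K) (hB : IsField 𝔅.B) {n : ℕ}
    {ρ : FramedRep (absoluteGaloisGroup K) (PadicAlgCl p) n}
    (hρ : ρ.IsDeRhamWith ‹Algebra ℚ_[p] K› 𝔅) :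
    ∃ (E' : IntermediateField ℚ_[p] (PadicAlgCl p)) (_ : FiniteDimensional ℚ_[p] E')
      (rE' : FramedRep (absoluteGaloisGroup K) E' n),
      HasQlModel ρ E' rE' ∧ Fintype.card (K →ₐ[ℚ_[p]] E') = Module.finrank ℚ_[p] K ∧
      (∀ τ : K →ₐ[ℚ_[p]] PadicAlgCl p, τ.fieldRange ≤ E') ∧
      𝔅.IsAdmissible ((FramedRep.toContinuousRep rE').restrictScalars ℚ_[p]) ∧
      ∀ τ : K →ₐ[ℚ_[p]] PadicAlgCl p, ∃ τ₀ : K →ₐ[ℚ_[p]] E',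
        τ.toRingHom = (extEmb (E := PadicAlgCl p) τ₀).toRingHom ∧
        FiniteDimensional E' (𝔅.labelD (FramedRep.toContinuousRep rE') τ₀.toRingHom) ∧
        Module.finrank E' (𝔅.labelD (FramedRep.toContinuousRep rE') τ₀.toRingHom) = n ∧
        (∀ i : ℤ, Module.finrank (PadicAlgCl p) (𝔅.labelFilD (FramedRep.toContinuousRep ρ) τ.toRingHom i) =
          Module.finrank E' (𝔅.labelFilD (FramedRep.toContinuousRep rE') τ₀.toRingHom i)) ∧
        𝔅.labelledHodgeTateWeights (FramedRep.toContinuousRep ρ) τ.toRingHom =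
          𝔅.labelledHodgeTateWeights (FramedRep.toContinuousRep rE') τ₀.toRingHom := by
  classical
  -- a finite model `rE₀` over `E₀`, enlarged to `E'` containing all embeddings of `K`
  obtain ⟨E₀, hfin₀, rE₀, hmodel₀, -⟩ := id hρ
  haveI : FiniteDimensional ℚ_[p] E₀ := hfin₀
  obtain ⟨E', hfin', hle, hE'⟩ := exists_intermediateField_ge_forall_fieldRange_le (K := K) E₀
  haveI : FiniteDimensional ℚ_[p] E' := hfin'
  have hsplit := card_algHom_eq_finrank_of_forall_fieldRange_le (K := K) E' hE'
  have hcont : Continuous (IntermediateField.inclusion hle).toRingHom := continuous_inclusion hle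
  let rE' : FramedRep (absoluteGaloisGroup K) E' n :=
    rE₀.baseChange (IntermediateField.inclusion hle).toRingHom hcont
  -- `rE'` is a model of `ρ`
  obtain ⟨Q, hQ⟩ := hmodel₀
  have hbc : rE'.baseChange (algebraMap E' (PadicAlgCl p)) continuous_subtype_val =
      rE₀.baseChange (algebraMap E₀ (PadicAlgCl p)) continuous_subtype_val :=
    ContinuousMonoidHom.ext fun g => Units.ext (Matrix.ext fun i j => rfl)
  have hmodel' : HasQlModel ρ E' rE' := ⟨Q, by rw [hbc, hQ]⟩
  -- the enlarged model is admissible (model independence of de Rham-ness)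
  have hadm : 𝔅.IsAdmissible ((FramedRep.toContinuousRep rE').restrictScalars ℚ_[p]) :=
    hρ.isAdmissible_of_hasQlModel ‹Algebra ℚ_[p] K› 𝔅 hmodel'
  haveI : ContinuousSMul ℚ_[p] E' := IntermediateField.continuousSMul_padicAlgCl E'
  refine ⟨E', hfin', rE', hmodel', hsplit, hE', hadm, fun τ => ?_⟩
  -- the embedding `τ` factors through `E'`
  let τ₀ : K →ₐ[ℚ_[p]] E' := (IntermediateField.inclusion (hE' τ)).comp τ.equivFieldRange.toAlgHom
  have hτ : τ.toRingHom = (extEmb (E := PadicAlgCl p) τ₀).toRingHom := RingHom.ext fun x => rfl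
  obtain ⟨hfinE', hrank⟩ := 𝔅.finrank_labelD_eq_of_isAdmissible hB (E := E') hsplit rE' hadm τ₀
  haveI := hfinE'
  exact ⟨τ₀, hτ, hfinE', hrank,
    fun i => finrank_labelFilD_eq_of_hasQlModel 𝔅 hmodel' hsplit τ τ₀ hτ i,
    labelledHodgeTateWeights_eq_of_hasQlModel 𝔅 hmodel' hsplit τ τ₀ hτ⟩

end FramedRep

end Literature.NumberTheory.GaloisRepresentations

end
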